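import Mathlib
import Summits.ResolutionOfSingularities.ResolutionOfSingularities.Theorems.WeightedInvariantLocalWeightedDropPolyDescentDefs
import Summits.ResolutionOfSingularities.ResolutionOfSingularities.Theorems.WeightedInvariantLocalWeightedDropMonicDescentShear
import Summits.ResolutionOfSingularities.ResolutionOfSingularities.Theorems.WeightedInvariantLocalWeightedDropMonicDescentInvariantLaws

/-!
# `WeightedInvariant.LocalWeightedDrop`, stub S3ρ `stub_wildMonicSurfaceReductionWon`, second key «monic polyhedron descent», port (ρ-S) part 1:
# THE SLOTWISE SHEAR KEEPS THE LEFTMOST COLUMN of the `d!`-scaled Newton set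

Crux item stmt-ResolutionOfSingularities-8899 `LocalWeightedDrop` (route `ResolutionOfSingularities/WeightedInvariant`), engine skeleton v30, stub
S3ρ.  [OURS · L1 W4.3, chain w43; port hand res-D-pv-058 (acting as res-L1-w43-stub-6) for res-L1-w43-lead-1's line «monic polyhedron descent»
(memo `L/res-L1-w43-lead-1/g3/S3RHO-CJS-MEMO.md` §1 (ρ-S)); MODEL Cossart–Jannsen–Saito LNM 2270 Lemma 13.6 (the `u₂`-shear does not touch the
leftmost column of the polyhedron), for a monic `y^d + Σ_{j<d} A_j(u₁,u₂) y^j` whose plane change `u₂ ↦ u₂ + u₁ h(u₁,u₂)` acts SLOT BY SLOT;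
the one-series instance is `PureDescent.coeff_shear_of_le_alphaL` / `alphaL_shear` / `betaL_shear` (p506022).  Nothing here is a statement of
any manuscript; no definitions.]

For a tuple `A : Fin d → k⟦u₁,u₂⟧` with scaled Newton set `N(A) = {w_j · e : [u^e]A_j ≠ 0}`, `w_j = d!/(d−j)` (`WildMonic.newtonSet`), and
the slotwise shear `shearT h A = (shear h A_j)_j` (res-L1-w43-lead-1's `…PolyDescentDefs`, p511326):
* `coeff_slotShear_of_le_alphaL` — the coefficients of `A_j` at exponents `e` with `w_j e₀ ≤ α(N(A))` are unchanged (so every vertex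
  polynomial on the column `α` is unchanged);
* `alphaL_le_fst_of_mem_newtonSet_slotShear` — the sheared Newton set lies in `P₀ ≥ α(N(A))`;
* `mem_newtonSet_slotShear_iff_of_le_alphaL` — on the column `P₀ ≤ α` the two Newton sets agree;
* `alphaL_newtonSet_slotShear`, `betaL_newtonSet_slotShear` — `α` and `β` (the lex-minimal vertex) are KEPT;
* `vertexCoeff_shearT_of_le_alphaL`, `solvable_shearT_iff_of_le_alphaL` — the vertex coefficients, hence (non-)solvability, of every scaled point on
  the column `P₀ ≤ α` are KEPT (so the lex-minimal vertex of a well-prepared label stays non-solvable after the shear).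
-/

set_option linter.dupNamespace false -- mandated namespace of this single-conjunct summit

namespace Summit.ResolutionOfSingularities.ResolutionOfSingularities.Theorems

namespace PolyDescent

open MvPowerSeries MonicDescent WildMonic

variable {k : Type} [Field k]

/-- Every exponent `e` of the slot `A_j` gives the Newton point `w_j · e`, so `α(N(A)) ≤ w_j · e₀`. -/
theorem alphaL_le_slotWeight_mul {d : ℕ} (A : Fin d → MvPowerSeries (Fin 2) k) (j : Fin d) {e : Fin 2 →₀ ℕ}
    (he : coeff e (A j) ≠ 0) : alphaL (newtonSet A) ≤ slotWeight d j * e 0 := by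
  have h := alphaL_le (N := newtonSet A) (P := slotWeight d j • e) ⟨j, e, he, rfl⟩
  rwa [Finsupp.smul_apply, smul_eq_mul] at h

/-- **The slotwise shear does not touch the column `w_j e₀ ≤ α`**: `[u^e](shear h A_j) = [u^e]A_j` whenever `w_j · e₀ ≤ α(N(A))`
(CJS Lemma 13.6, slot by slot: `u₁^{a} ∣ A_j` for the least `u₁`-exponent `a` of `A_j`, and `w_j a ≥ α`). -/
theorem coeff_slotShear_of_le_alphaL {d : ℕ} (h : MvPowerSeries (Fin 2) k) (A : Fin d → MvPowerSeries (Fin 2) k) (j : Fin d)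
    {e : Fin 2 →₀ ℕ} (he : slotWeight d j * e 0 ≤ alphaL (newtonSet A)) : coeff e (shearT h A j) = coeff e (A j) := by
  refine coeff_shear_of_le h (A j) (e 0) (fun e' he' => ?_) e le_rfl
  exact Nat.le_of_mul_le_mul_left (le_trans he (alphaL_le_slotWeight_mul A j he')) (slotWeight_pos j)

/-- **The sheared Newton set lies in the half-plane `P₀ ≥ α(N(A))`.** -/
theorem alphaL_le_fst_of_mem_newtonSet_slotShear {d : ℕ} (h : MvPowerSeries (Fin 2) k) (A : Fin d → MvPowerSeries (Fin 2) k)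
    {P : Fin 2 →₀ ℕ} (hP : P ∈ newtonSet (shearT h A)) : alphaL (newtonSet A) ≤ P 0 := by
  obtain ⟨j, e, he, rfl⟩ := hP
  rw [Finsupp.smul_apply, smul_eq_mul]
  by_contra hlt
  rw [not_le] at hlt
  have hco : coeff e (shearT h A j) = coeff e (A j) := coeff_slotShear_of_le_alphaL h A j hlt.le
  have he' : coeff e (A j) ≠ 0 := by rwa [hco] at he
  exact absurd (alphaL_le_slotWeight_mul A j he') (not_le.mpr hlt)

/-- **On the column `P₀ ≤ α(N(A))` the Newton sets of `A` and of its slotwise shear agree.** -/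
theorem mem_newtonSet_slotShear_iff_of_le_alphaL {d : ℕ} (h : MvPowerSeries (Fin 2) k) (A : Fin d → MvPowerSeries (Fin 2) k)
    {P : Fin 2 →₀ ℕ} (hP0 : P 0 ≤ alphaL (newtonSet A)) :
    P ∈ newtonSet (shearT h A) ↔ P ∈ newtonSet A := by
  constructor
  · rintro ⟨j, e, he, rfl⟩
    rw [Finsupp.smul_apply, smul_eq_mul] at hP0
    have he' : coeff e (A j) ≠ 0 := by rwa [coeff_slotShear_of_le_alphaL h A j hP0] at he
    exact ⟨j, e, he', rfl⟩
  · rintro ⟨j, e, he, rfl⟩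
    rw [Finsupp.smul_apply, smul_eq_mul] at hP0
    have he' : coeff e (shearT h A j) ≠ 0 := by rwa [coeff_slotShear_of_le_alphaL h A j hP0]
    exact ⟨j, e, he', rfl⟩

/-- The sheared Newton set of a non-zero tuple is non-empty (the point attaining `α` is kept). -/
theorem newtonSet_slotShear_nonempty {d : ℕ} (h : MvPowerSeries (Fin 2) k) {A : Fin d → MvPowerSeries (Fin 2) k}
    (hne : (newtonSet A).Nonempty) : (newtonSet (shearT h A)).Nonempty := by
  obtain ⟨P, hP, hP0⟩ := exists_eq_alphaL hne
  exact ⟨P, (mem_newtonSet_slotShear_iff_of_le_alphaL h A hP0.le).mpr hP⟩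

/-- **`α` IS KEPT by the slotwise shear** (CJS Lemma 13.6 for tuples). -/
theorem alphaL_newtonSet_slotShear {d : ℕ} (h : MvPowerSeries (Fin 2) k) {A : Fin d → MvPowerSeries (Fin 2) k}
    (hne : (newtonSet A).Nonempty) : alphaL (newtonSet (shearT h A)) = alphaL (newtonSet A) := by
  obtain ⟨P, hP, hP0⟩ := exists_eq_alphaL hne
  have hPS : P ∈ newtonSet (shearT h A) := (mem_newtonSet_slotShear_iff_of_le_alphaL h A hP0.le).mpr hP
  apply le_antisymm
  · rw [← hP0]; exact alphaL_le hPS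
  · obtain ⟨Q, hQ, hQ0⟩ := exists_eq_alphaL (⟨P, hPS⟩ : (newtonSet (shearT h A)).Nonempty)
    rw [← hQ0]; exact alphaL_le_fst_of_mem_newtonSet_slotShear h A hQ

/-- **`β` IS KEPT by the slotwise shear**: the lex-minimal vertex `(α, β)` of the scaled Newton set survives (CJS Lemma 13.6 for tuples). -/
theorem betaL_newtonSet_slotShear {d : ℕ} (h : MvPowerSeries (Fin 2) k) {A : Fin d → MvPowerSeries (Fin 2) k}
    (hne : (newtonSet A).Nonempty) : betaL (newtonSet (shearT h A)) = betaL (newtonSet A) := by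
  have hα := alphaL_newtonSet_slotShear h hne
  obtain ⟨P, hP, hP0, hP1⟩ := exists_eq_betaL hne
  have hPS : P ∈ newtonSet (shearT h A) := (mem_newtonSet_slotShear_iff_of_le_alphaL h A hP0.le).mpr hP
  apply le_antisymm
  · rw [← hP1]; exact betaL_le hPS (by rw [hα]; exact hP0)
  · obtain ⟨Q, hQ, hQ0, hQ1⟩ := exists_eq_betaL (⟨P, hPS⟩ : (newtonSet (shearT h A)).Nonempty)
    rw [hα] at hQ0
    have hQA : Q ∈ newtonSet A := (mem_newtonSet_slotShear_iff_of_le_alphaL h A hQ0.le).mp hQ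
    rw [← hQ1]; exact betaL_le hQA hQ0

/-- **The lex-minimal vertex is a Newton point of the sheared tuple iff it is one of the tuple** (the case `P₀ = α` of
`mem_newtonSet_slotShear_iff_of_le_alphaL`, in the invariants of the SHEARED set). -/
theorem mem_newtonSet_slotShear_iff_of_fst_eq_alphaL {d : ℕ} (h : MvPowerSeries (Fin 2) k) {A : Fin d → MvPowerSeries (Fin 2) k}
    (hne : (newtonSet A).Nonempty) {P : Fin 2 →₀ ℕ} (hP0 : P 0 = alphaL (newtonSet (shearT h A))) :
    P ∈ newtonSet (shearT h A) ↔ P ∈ newtonSet A :=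
  mem_newtonSet_slotShear_iff_of_le_alphaL h A (by rw [hP0, alphaL_newtonSet_slotShear h hne])

/-! ## Vertex coefficients on the column `P₀ ≤ α` -/

/-- **The vertex coefficients of every scaled point on the column `P₀ ≤ α(N(A))` are unchanged by the slotwise shear** (so the vertex
polynomials `Y^d + Σ_j vertexCoeff_j Y^j` there are unchanged). -/
theorem vertexCoeff_shearT_of_le_alphaL {d : ℕ} (h : MvPowerSeries (Fin 2) k) (A : Fin d → MvPowerSeries (Fin 2) k)
    {P : Fin 2 →₀ ℕ} (hP0 : P 0 ≤ alphaL (newtonSet A)) (j : Fin d) : vertexCoeff d (shearT h A) P j = vertexCoeff d A P j := by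
  by_cases hdvd : ∀ i, slotWeight d j ∣ P i
  · rw [vertexCoeff_of_dvd _ hdvd, vertexCoeff_of_dvd _ hdvd]
    refine coeff_slotShear_of_le_alphaL h A j (le_trans ?_ hP0)
    rw [Finsupp.add_apply, Finsupp.single_eq_same, Finsupp.single_eq_of_ne (by decide), add_zero]
    exact Nat.mul_div_le (P 0) (slotWeight d j)
  · rw [vertexCoeff_of_not_dvd _ hdvd, vertexCoeff_of_not_dvd _ hdvd]

/-- **Solvability of a scaled point on the column `P₀ ≤ α(N(A))` is unchanged by the slotwise shear.** -/
theorem solvable_shearT_iff_of_le_alphaL {d : ℕ} (h : MvPowerSeries (Fin 2) k) (A : Fin d → MvPowerSeries (Fin 2) k)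
    {P : Fin 2 →₀ ℕ} (hP0 : P 0 ≤ alphaL (newtonSet A)) : Solvable d (shearT h A) P ↔ Solvable d A P := by
  unfold Solvable
  simp only [vertexCoeff_shearT_of_le_alphaL h A hP0]

end PolyDescent

end Summit.ResolutionOfSingularities.ResolutionOfSingularities.Theorems
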